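import Mathlib
import HarnessLib
import Literature.MeasureTheory.Lebesgue.PolynomialZeroSet

/-!
# Stub `stub_atomReduction` (line `torus-descent-sum-shadow`, crux `DihedralNormalForm`), tools I:
Laurent monomials on coordinate boxes and the lowest-power lemma

Registered sub-goal of this file: `stub_atomReduction_lowestPower`.

* `integrableOn_prod_zpow` — `∏ᵢ yᵢ^{Dᵢ}` (`D ∈ ℤᵏ`) is integrable on the open unit cube as soon as
  every `Dᵢ > -1` (Fubini, `MeasureTheory.Integrable.fintype_prod`, and the one-variable criterion
  `intervalIntegral.integrableOn_Ioo_rpow_iff`);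
* `neg_one_lt_of_integrableOn_zpow` — conversely, if `y ↦ yᵢ^e` is integrable on a coordinate box
  whose `i`-th side is `(0, δ)` (the other sides of positive measure), then `e > -1`;
* `integrableOn_cube_comp_one_sub_iff` — the flip `x ↦ 1 - x` of the open unit cube preserves
  integrability;
* **Lemma B** `neg_one_lt_of_integrableOn_abs_eval_mul` — if `R ∈ ℝ[y₀, …, y_n]`, `Γ ∈ ℤⁿ⁺¹`,
  `t > 0` and `|R(y)| · ∏ yₗ^{Γₗ}` is integrable on the box `(0, t)ⁿ⁺¹`, then every monomial `y^μ`
  of `R` satisfies `μᵢ + Γᵢ > -1` for every `i`. Proof: divide `R` by the largest power `yᵢ^{n₀}`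
  dividing it (`MvPolynomial.divMonomial`); the quotient has a non-zero constant term `Q` in `yᵢ`,
  non-zero at some point `y⋆` of the box (its zero set is null,
  `MvPolynomial.volume_zeroSet_eq_zero`); by continuity at the boundary point `y⋆|_{yᵢ = 0}` the
  integrand dominates `c · yᵢ^{n₀ + Γᵢ}` on a small coordinate box with `i`-th side `(0, δ)`, and
  the one-variable criterion forces `n₀ + Γᵢ > -1`.

Recurring terms are written through parse-time notations (`CP⟪⟫`, `ATOM⟪⟫`, `SEC⟪⟫`, `NC⟪⟫`,
`CHORD⟪⟫`, `WEIGHT⟪⟫`, `EXPL⟪⟫`, `CPOLY⟪⟫`, `DIAG⟪⟫`, …); the files introduce no definitions.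
-/

noncomputable section

open MeasureTheory Set MvPolynomial Filter Topology

namespace Summit.KontsevichZagierPeriods.DihedralNormalForm.TorusDescent.AtomReduction

/-! ### Boxes and product measures -/

/-- Lebesgue measure on `ℝᵏ` restricted to a coordinate box is the product of the restricted
one-dimensional Lebesgue measures. -/
theorem volume_restrict_pi_eq (k : ℕ) (s : Fin k → Set ℝ) :
    (volume : Measure (Fin k → ℝ)).restrict (Set.pi univ s) =
      Measure.pi fun i => (volume : Measure ℝ).restrict (s i) := by
  rw [volume_pi, Measure.restrict_pi_pi]

/-- The open unit cube is the coordinate box `∏ (0, 1)`. -/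
theorem cube_eq_pi (k : ℕ) :
    {x : Fin k → ℝ | ∀ i, x i ∈ Ioo (0:ℝ) 1} = Set.pi univ fun _ => Ioo (0:ℝ) 1 := by
  ext x
  simp

/-- The open unit cube is measurable. -/
theorem measurableSet_cube (k : ℕ) :
    MeasurableSet {x : Fin k → ℝ | ∀ i, x i ∈ Ioo (0:ℝ) 1} := by
  rw [cube_eq_pi]
  exact MeasurableSet.univ_pi fun _ => measurableSet_Ioo

/-- An integer power `t ↦ t ^ e` is integrable on `(0, δ)` iff `-1 < e`. -/
theorem integrableOn_Ioo_zpow_iff {δ : ℝ} (hδ : 0 < δ) (e : ℤ) :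
    IntegrableOn (fun t : ℝ => t ^ e) (Ioo (0:ℝ) δ) ↔ -1 < e := by
  have h : IntegrableOn (fun t : ℝ => t ^ e) (Ioo (0:ℝ) δ) ↔
      IntegrableOn (fun t : ℝ => t ^ ((e : ℤ) : ℝ)) (Ioo (0:ℝ) δ) :=
    integrableOn_congr_fun (fun t _ => (Real.rpow_intCast t e).symm) measurableSet_Ioo
  rw [h, intervalIntegral.integrableOn_Ioo_rpow_iff hδ]
  exact_mod_cast Iff.rfl

/-- **Monomial integrability, sufficient direction.** If every exponent exceeds `-1`, the Laurent
monomial `∏ᵢ yᵢ^{Dᵢ}` is integrable on the open unit cube. -/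
theorem integrableOn_prod_zpow {k : ℕ} (D : Fin k → ℤ) (hD : ∀ i, -1 < D i) :
    IntegrableOn (fun y : Fin k → ℝ => ∏ i, y i ^ D i) {x | ∀ i, x i ∈ Ioo (0:ℝ) 1} := by
  rw [IntegrableOn, cube_eq_pi, volume_restrict_pi_eq]
  exact Integrable.fintype_prod (f := fun i (t : ℝ) => t ^ D i)
    fun i => (integrableOn_Ioo_zpow_iff zero_lt_one (D i)).2 (hD i)

/-- **Monomial integrability, necessary direction.** If `y ↦ yᵢ^e` is integrable on a coordinate
box whose `i`-th side is `(0, δ)` and whose other sides have positive length, then `-1 < e`. -/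
theorem neg_one_lt_of_integrableOn_zpow {n : ℕ} (i : Fin (n + 1)) (s : Fin (n + 1) → Set ℝ)
    (hs : ∀ l, volume (s l) ≠ 0) {δ : ℝ} (hδ : 0 < δ) (hsi : s i = Ioo 0 δ) (e : ℤ)
    (h : IntegrableOn (fun y : Fin (n + 1) → ℝ => y i ^ e) (Set.pi univ s)) : -1 < e := by
  rw [IntegrableOn, volume_restrict_pi_eq] at h
  set μ : Fin (n + 1) → Measure ℝ := fun l => (volume : Measure ℝ).restrict (s l) with hμ
  have hmp := (measurePreserving_piFinSuccAbove μ i).symm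
  have h2 := (hmp.integrable_comp_emb (MeasurableEquiv.measurableEmbedding _)).2 h
  have hfun : ((fun y : Fin (n + 1) → ℝ => y i ^ e) ∘
      (MeasurableEquiv.piFinSuccAbove (fun _ => ℝ) i).symm) = fun p => p.1 ^ e := by
    funext p
    simp [MeasurableEquiv.piFinSuccAbove_symm_apply]
  rw [hfun] at h2
  have h3 := h2.prod_left_ae
  have hν : (Measure.pi fun j => μ (i.succAbove j)) ≠ 0 := by
    intro h0
    have := congrArg (fun m => m univ) h0
    simp only [Measure.pi_univ, Measure.coe_zero, Pi.zero_apply, Finset.prod_eq_zero_iff,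
      Finset.mem_univ, true_and] at this
    obtain ⟨j, hj⟩ := this
    rw [hμ, Measure.restrict_apply_univ] at hj
    exact hs _ hj
  haveI : (ae (Measure.pi fun j => μ (i.succAbove j))).NeBot := ae_neBot.2 hν
  obtain ⟨_, h4⟩ := h3.exists
  have h5 : IntegrableOn (fun t : ℝ => t ^ e) (Ioo (0:ℝ) δ) := by
    rw [← hsi]; exact h4
  exact (integrableOn_Ioo_zpow_iff hδ e).1 h5

/-- **The flip `x ↦ 1 - x` preserves integrability on the open unit cube** (it is a
measure-preserving involution of `ℝᵏ` mapping the cube to itself). -/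
theorem integrableOn_cube_comp_one_sub_iff {k : ℕ} (f : (Fin k → ℝ) → ℝ) :
    IntegrableOn (fun v : Fin k → ℝ => f (fun i => 1 - v i)) {x | ∀ i, x i ∈ Ioo (0:ℝ) 1} ↔
      IntegrableOn f {x | ∀ i, x i ∈ Ioo (0:ℝ) 1} := by
  let e : (Fin k → ℝ) ≃ᵐ (Fin k → ℝ) :=
    { toFun := fun v i => 1 - v i
      invFun := fun v i => 1 - v i
      left_inv := fun v => by funext i; simp
      right_inv := fun v => by funext i; simp
      measurable_toFun := measurable_pi_iff.2 fun i => measurable_const.sub (measurable_pi_apply i)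
      measurable_invFun := measurable_pi_iff.2 fun i =>
        measurable_const.sub (measurable_pi_apply i) }
  have he : MeasurePreserving e volume volume :=
    volume_preserving_pi fun _ : Fin k => Measure.measurePreserving_sub_left (volume : Measure ℝ) 1
  have hpre : e ⁻¹' {x : Fin k → ℝ | ∀ i, x i ∈ Ioo (0:ℝ) 1} = {x | ∀ i, x i ∈ Ioo (0:ℝ) 1} := by
    ext v
    simp only [e, MeasurableEquiv.coe_mk, Equiv.coe_fn_mk, mem_preimage, mem_setOf_eq, mem_Ioo,
      sub_pos, sub_lt_self_iff]
    exact forall_congr' fun i => and_comm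
  have h := he.integrableOn_comp_preimage e.measurableEmbedding (f := f)
    (s := {x : Fin k → ℝ | ∀ i, x i ∈ Ioo (0:ℝ) 1})
  rw [hpre] at h
  exact h

/-- A function is integrable on every Lebesgue-null set. -/
theorem integrableOn_of_volume_eq_zero {k : ℕ} (f : (Fin k → ℝ) → ℝ) {Z : Set (Fin k → ℝ)}
    (hZ : volume Z = 0) : IntegrableOn f Z := by
  rw [IntegrableOn, Measure.restrict_eq_zero.2 hZ]
  exact integrable_zero_measure


/-! ### Algebra: dividing off the lowest power of one variable -/

section Algebra

variable {σ : Type*} {K : Type*} [CommRing K]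

/-- If every monomial of `R` is divisible by `y^s`, then `R = y^s · (R / y^s)`. -/
theorem eq_monomial_mul_divMonomial (R : MvPolynomial σ K) (s : σ →₀ ℕ)
    (hs : ∀ ν ∈ R.support, s ≤ ν) : R = monomial s 1 * R.divMonomial s := by
  classical
  have hmod : R.modMonomial s = 0 := by
    ext ν
    rw [coeff_zero]
    by_cases hle : s ≤ ν
    · exact coeff_modMonomial_of_le _ hle
    · rw [coeff_modMonomial_of_not_le _ hle]
      by_contra hne
      exact hle (hs ν (mem_support_iff.2 hne))
  have := divMonomial_add_modMonomial R s
  rw [hmod, add_zero] at this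
  exact this.symm

/-- The remainder of `R` modulo `Xᵢ` does not involve the variable `i`. -/
theorem notMem_vars_modMonomial_single [DecidableEq σ] (R : MvPolynomial σ K) (i : σ) :
    i ∉ (R.modMonomial (Finsupp.single i 1)).vars := by
  rw [mem_vars_iff_mem_support]
  rintro ⟨ν, hν, hi⟩
  rw [mem_support_iff] at hν
  apply hν
  apply coeff_modMonomial_of_le
  rw [Finsupp.single_le_iff]
  exact Nat.one_le_iff_ne_zero.2 (Finsupp.mem_support_iff.1 hi)

/-- Evaluation of a polynomial not involving the variable `i` does not depend on the `i`-th
coordinate. -/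
theorem eval_update_eq_of_notMem_vars [DecidableEq σ] {R : MvPolynomial σ K} {i : σ}
    (hi : i ∉ R.vars) (y : σ → K) (c : K) : eval (Function.update y i c) R = eval y R := by
  refine eval₂Hom_congr' rfl (fun l hl _ => ?_) rfl
  have : l ≠ i := fun h => hi (h ▸ hl)
  rw [Function.update_of_ne this]

end Algebra

/-! ### Lemma B -/

/-- The coordinate box `(0, t)ᵏ` has positive Lebesgue measure for `t > 0`. -/
theorem volume_box_ne_zero (k : ℕ) {t : ℝ} (ht : 0 < t) :
    volume (Set.pi univ fun _ : Fin k => Ioo (0:ℝ) t) ≠ 0 := by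
  rw [volume_pi_pi]
  refine Finset.prod_ne_zero_iff.2 fun l _ => ?_
  rw [Real.volume_Ioo]
  simpa using ht

/-- A non-zero real polynomial does not vanish identically on the box `(0, t)ᵏ`. -/
theorem exists_eval_ne_zero_of_ne_zero {k : ℕ} (Q : MvPolynomial (Fin k) ℝ) (hQ : Q ≠ 0)
    {t : ℝ} (ht : 0 < t) :
    ∃ y ∈ Set.pi univ (fun _ : Fin k => Ioo (0:ℝ) t), eval y Q ≠ 0 := by
  by_contra! h
  have hsub : Set.pi univ (fun _ : Fin k => Ioo (0:ℝ) t) ⊆ {x | eval x Q = 0} := fun y hy => h y hy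
  have := measure_mono_null hsub (MvPolynomial.volume_zeroSet_eq_zero k Q hQ)
  exact volume_box_ne_zero k ht this

/-- **Lemma B (lowest power).** If `|R(y)| · ∏ₗ yₗ^{Γₗ}` is integrable on the box `(0, t)ⁿ⁺¹`,
then every monomial `y^μ` of `R` has `μᵢ + Γᵢ > -1` for every coordinate `i`. -/
theorem neg_one_lt_of_integrableOn_abs_eval_mul {n : ℕ} (R : MvPolynomial (Fin (n + 1)) ℝ)
    (Γ : Fin (n + 1) → ℤ) {t : ℝ} (ht : 0 < t)
    (hint : IntegrableOn (fun y => |eval y R| * ∏ l, y l ^ Γ l)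
      (Set.pi univ fun _ : Fin (n + 1) => Ioo (0:ℝ) t)) :
    ∀ μ ∈ R.support, ∀ i, -1 < (μ i : ℤ) + Γ i := by
  classical
  intro μ hμ i
  -- the lowest exponent of `yᵢ`
  set S := R.support with hS
  have hSne : S.Nonempty := ⟨μ, hμ⟩
  set n₀ := (S.image fun ν => ν i).min' (hSne.image _) with hn₀
  have hn₀le : ∀ ν ∈ S, n₀ ≤ ν i := fun ν hν =>
    Finset.min'_le _ _ (Finset.mem_image_of_mem (fun ν => ν i) hν)
  obtain ⟨μ₀, hμ₀S, hμ₀i⟩ : ∃ μ₀ ∈ S, μ₀ i = n₀ := by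
    have := Finset.min'_mem (S.image fun ν => ν i) (hSne.image _)
    rw [Finset.mem_image] at this
    obtain ⟨μ₀, h1, h2⟩ := this
    exact ⟨μ₀, h1, h2⟩
  suffices h : -1 < (n₀ : ℤ) + Γ i by
    have := hn₀le μ hμ
    omega
  -- divide by `yᵢ^{n₀}`
  set s : Fin (n + 1) →₀ ℕ := Finsupp.single i n₀ with hs_def
  have hsle : ∀ ν ∈ S, s ≤ ν := fun ν hν => Finsupp.single_le_iff.2 (hn₀le ν hν)
  set Rh := R.divMonomial s with hRh_def
  have hR : R = monomial s 1 * Rh := eq_monomial_mul_divMonomial R s hsle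
  have hevalR : ∀ y : Fin (n + 1) → ℝ, eval y R = y i ^ n₀ * eval y Rh := by
    intro y
    have hsprod : s.prod (fun l e => y l ^ e) = y i ^ n₀ := by
      rw [hs_def, Finsupp.prod_single_index]
      exact pow_zero _
    rw [hR, map_mul, eval_monomial, hsprod, one_mul]
  -- the constant term of `Rh` in `yᵢ`
  set s1 : Fin (n + 1) →₀ ℕ := Finsupp.single i 1 with hs1_def
  set Q := Rh.modMonomial s1 with hQ_def
  set W := Rh.divMonomial s1 with hW_def
  have hRh : ∀ y : Fin (n + 1) → ℝ, eval y Rh = y i * eval y W + eval y Q := by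
    intro y
    have := divMonomial_add_modMonomial_single Rh i
    conv_lhs => rw [← this]
    rw [map_add, map_mul, eval_X]
  have hQ0 : Q ≠ 0 := by
    intro hQ
    have h1 : coeff (μ₀ - s) Q = coeff μ₀ R := by
      have hnle : ¬ s1 ≤ μ₀ - s := by
        rw [Finsupp.single_le_iff, Finsupp.tsub_apply, hμ₀i, hs_def, Finsupp.single_eq_same]
        omega
      rw [hQ_def, coeff_modMonomial_of_not_le _ hnle, hRh_def, coeff_divMonomial,
        add_tsub_cancel_of_le (hsle μ₀ hμ₀S)]
    rw [hQ, coeff_zero] at h1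
    exact (mem_support_iff.1 hμ₀S) h1.symm
  have hiQ : i ∉ Q.vars := notMem_vars_modMonomial_single Rh i
  -- a point of the box where `Q ≠ 0`
  obtain ⟨ys, hys, hQys⟩ := exists_eval_ne_zero_of_ne_zero Q hQ0 ht
  have hys' : ∀ l, ys l ∈ Ioo (0:ℝ) t := fun l => hys l (mem_univ _)
  set z : Fin (n + 1) → ℝ := Function.update ys i 0 with hz
  have hzQ : eval z Rh = eval ys Q := by
    rw [hRh, hz, Function.update_self, zero_mul, zero_add, eval_update_eq_of_notMem_vars hiQ]
  -- the comparison function `Φ`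
  set Φ : (Fin (n + 1) → ℝ) → ℝ := fun y => |eval y Rh| * ∏ l ∈ Finset.univ.erase i, y l ^ Γ l
    with hΦ
  have hzl : ∀ l ∈ Finset.univ.erase i, z l = ys l := fun l hl => by
    rw [hz, Function.update_of_ne (Finset.ne_of_mem_erase hl)]
  have hΦz : 0 < Φ z := by
    refine mul_pos (abs_pos.2 (by rwa [hzQ])) (Finset.prod_pos fun l hl => ?_)
    rw [hzl l hl]
    exact zpow_pos (hys' l).1 _
  have hΦc : ContinuousAt Φ z := by
    refine ContinuousAt.mul (continuous_abs.comp (continuous_eval Rh)).continuousAt ?_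
    refine tendsto_finsetProd _ fun l hl => ?_
    refine ((continuous_apply l).continuousAt).zpow₀ _ (Or.inl ?_)
    rw [hzl l hl]
    exact (hys' l).1.ne'
  -- a neighbourhood of `z` where `Φ > Φ z / 2`
  have hU : Φ ⁻¹' Ioi (Φ z / 2) ∈ 𝓝 z := hΦc.preimage_mem_nhds (Ioi_mem_nhds (by linarith))
  obtain ⟨ε, hε, hball⟩ := Metric.mem_nhds_iff.1 hU
  -- a ball around `ys` inside the box
  have hopen : IsOpen (Set.pi univ fun _ : Fin (n + 1) => Ioo (0:ℝ) t) :=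
    isOpen_set_pi finite_univ fun _ _ => isOpen_Ioo
  obtain ⟨ε', hε', hball'⟩ := Metric.isOpen_iff.1 hopen ys hys
  set δ₁ : ℝ := min (min ε ε') t / 2 with hδ₁
  have hδ₁pos : 0 < δ₁ := by positivity
  have hδ₁ε : δ₁ < ε := by
    have : min (min ε ε') t ≤ ε := (min_le_left _ _).trans (min_le_left _ _)
    rw [hδ₁]; linarith
  have hδ₁ε' : δ₁ < ε' := by
    have : min (min ε ε') t ≤ ε' := (min_le_left _ _).trans (min_le_right _ _)
    rw [hδ₁]; linarith
  have hδ₁t : δ₁ < t := by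
    have : min (min ε ε') t ≤ t := min_le_right _ _
    rw [hδ₁]; linarith
  -- the small box
  set b : Fin (n + 1) → Set ℝ := fun l => if l = i then Ioo 0 δ₁ else Ioo (ys l - δ₁) (ys l + δ₁)
    with hb
  set B := Set.pi univ b with hB
  have hBball : B ⊆ Metric.ball z ε := by
    intro y hy
    rw [Metric.mem_ball, dist_pi_lt_iff hε]
    intro l
    have hyl := hy l (mem_univ _)
    by_cases hl : l = i
    · subst hl
      simp only [hb, if_true] at hyl
      rw [hz, Function.update_self, Real.dist_eq, sub_zero, abs_of_pos hyl.1]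
      exact hyl.2.trans hδ₁ε
    · simp only [hb, hl, if_false] at hyl
      rw [hz, Function.update_of_ne hl, Real.dist_eq, abs_sub_lt_iff]
      constructor <;> linarith [hyl.1, hyl.2]
  have hBbox : B ⊆ Set.pi univ fun _ : Fin (n + 1) => Ioo (0:ℝ) t := by
    intro y hy l _
    have hyl := hy l (mem_univ _)
    by_cases hl : l = i
    · subst hl
      simp only [hb, if_true] at hyl
      exact ⟨hyl.1, hyl.2.trans hδ₁t⟩
    · -- compare with the point `y' = update y i (ys i) ∈ ball ys ε'`
      have hy' : Function.update y i (ys i) ∈ Metric.ball ys ε' := by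
        rw [Metric.mem_ball, dist_pi_lt_iff hε']
        intro l'
        by_cases hl' : l' = i
        · subst hl'
          rw [Function.update_self, dist_self]
          exact hε'
        · have hyl' := hy l' (mem_univ _)
          simp only [hb, hl', if_false] at hyl'
          rw [Function.update_of_ne hl', Real.dist_eq, abs_sub_lt_iff]
          constructor <;> linarith [hyl'.1, hyl'.2]
      have := hball' hy' l (mem_univ _)
      rwa [Function.update_of_ne hl] at this
  -- the lower bound on the small box
  have hlow : ∀ y ∈ B, Φ z / 2 * y i ^ ((n₀ : ℤ) + Γ i) ≤ |eval y R| * ∏ l, y l ^ Γ l ∧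
      0 ≤ y i ^ ((n₀ : ℤ) + Γ i) := by
    intro y hy
    have hyi : 0 < y i := by
      have := hy i (mem_univ _)
      simp only [hb, if_true] at this
      exact this.1
    have hΦy : Φ z / 2 < Φ y := hball (hBball hy)
    have hsplit : |eval y R| * ∏ l, y l ^ Γ l = y i ^ ((n₀ : ℤ) + Γ i) * Φ y := by
      rw [hevalR, ← Finset.mul_prod_erase Finset.univ (fun l => y l ^ Γ l) (Finset.mem_univ i),
        abs_mul, abs_of_pos (pow_pos hyi _), zpow_add₀ hyi.ne', zpow_natCast, hΦ]
      ring
    refine ⟨?_, (zpow_pos hyi _).le⟩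
    rw [hsplit, mul_comm]
    exact mul_le_mul_of_nonneg_left hΦy.le (zpow_pos hyi _).le
  -- integrability of `yᵢ^{n₀ + Γᵢ}` on the small box
  have hBm : MeasurableSet B := MeasurableSet.univ_pi fun l => by
    simp only [hb]
    split_ifs <;> exact measurableSet_Ioo
  have hintB : IntegrableOn (fun y : Fin (n + 1) → ℝ => y i ^ ((n₀ : ℤ) + Γ i)) B := by
    have h1 : IntegrableOn (fun y => 2 / Φ z * (|eval y R| * ∏ l, y l ^ Γ l)) B :=
      (hint.mono_set hBbox).const_mul _
    refine Integrable.mono' h1 ?_ ?_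
    · exact ((measurable_pi_apply i).pow_const _).aestronglyMeasurable
    · refine ae_restrict_of_forall_mem hBm fun y hy => ?_
      obtain ⟨h2, h3⟩ := hlow y hy
      rw [Real.norm_of_nonneg h3]
      have h4 : y i ^ ((n₀ : ℤ) + Γ i) = 2 / Φ z * (Φ z / 2 * y i ^ ((n₀ : ℤ) + Γ i)) := by
        field_simp
      rw [h4]
      exact mul_le_mul_of_nonneg_left h2 (by positivity)
  -- conclusion from the one-variable criterion
  refine neg_one_lt_of_integrableOn_zpow i b (fun l => ?_) hδ₁pos (by simp [hb]) _ hintB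
  simp only [hb]
  split_ifs
  · rw [Real.volume_Ioo]; simpa using hδ₁pos
  · rw [Real.volume_Ioo]
    have : 0 < ys l + δ₁ - (ys l - δ₁) := by linarith
    simpa using this


/-- **Registered sub-goal `stub_atomReduction_lowestPower`** (tools I): the lowest-power lemma. -/
theorem stub_atomReduction_lowestPower : ∀ (n : ℕ) (R : MvPolynomial (Fin (n + 1)) ℝ) (Γ : Fin (n + 1) → ℤ) (t : ℝ), 0 < t → MeasureTheory.IntegrableOn (fun y : Fin (n + 1) → ℝ => |MvPolynomial.eval y R| * ∏ l, y l ^ Γ l) (Set.pi Set.univ fun _ : Fin (n + 1) => Set.Ioo (0:ℝ) t) MeasureTheory.volume → ∀ μ ∈ R.support, ∀ i, -1 < (μ i : ℤ) + Γ i :=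
  fun _ R Γ _ ht h => neg_one_lt_of_integrableOn_abs_eval_mul R Γ ht h

end Summit.KontsevichZagierPeriods.DihedralNormalForm.TorusDescent.AtomReduction
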